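import Mathlib
import HarnessLib
import Literature.Computability.AlgebraicComplexity.BLMW11VPwsBarSubsetVPBar
import Literature.Computability.AlgebraicComplexity.BLMW11ApproximationProjections
import Summits.ValiantsHypothesis.ValiantsHypothesis.Theorems.DefinabilityGapK1Necessary

/-!
# DefinabilityGap — K1ws is NECESSARY too: Valiant's hypothesis ⟹ the planted map hits weakly-skew adversaries i.o.
# (support for `KIPlantedHittingWs`, item `stmt-ValiantsHypothesis-23701`; unconditional kernel)

The split child K1ws of crux K1 (route `route-ValiantsHypothesis-DefinabilityGap`) asks that for every `b` and cofinally many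
`m` no nonzero `D` of weakly-skew complexity `L_ws(D) ≤ q(m)^b` annihilates the planted KI-permanent map `G_m = kiPer m`.
Since `L(D) ≤ L_ws(D)` (`complexity_le_wsComplexity`) and `deg D ≤ L_ws(D) + 1` (`totalDegree_le_wsComplexity_succ`, BLMW 2011
§9.1), a weakly-skew adversary of level `b` is a circuit adversary of level `b + 1`; so the hypothesis-free pointwise theorem
`DefinabilityGapK1Necessary.kiPer_hits_of_perm_hard` and `VP_ℂ ≠ VNP_ℂ ⟹ K1` (`kiPlantedHitting_of_VP_ne_VNP`) descend to the
weakly-skew currency: `kiPer_hitsWs_of_perm_hard`, `kiPlantedHittingWs_of_VP_ne_VNP` (the statement of K1ws verbatim in the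
`qOf`/`kiPer` spelling), and the dichotomy `VP_eq_VNP_of_not_kiPlantedHittingWs`. Compare `DefinabilityGapWeakToK1ws`, which
reaches K1ws from the WEAK hypothesis `(per_m) ∉ VP_ws` but only modulo `VBP` factor closure: from the full hypothesis no
factor closure is needed. Consequence for the route: K1ws, like K1, is a consequence of the summit (on-path, no misstatement
risk); the glued split `K1 ⟸ K1ws ∧ Bws` together with `S ⟹ K1ws` and the vacuous `S ⟹ Bws` is exact. No route file imported.

## References

* [KabanetsImpagliazzo2003] V. Kabanets, R. Impagliazzo, *Derandomizing polynomial identity tests means proving circuit lower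
  bounds*, comput. complexity 13 (2004), Lemma 30, Thm. 7.7.
* [BurgisserEtAl2011] P. Bürgisser, J.M. Landsberg, L. Manivel, J. Weyman, *An overview of mathematical issues arising in the
  geometric complexity theory approach to VP ≠ VNP*, SIAM J. Comput. 40 (2011), §9.1.
* [Vonzurgathen1987Feasible] J. von zur Gathen, *Feasible arithmetic computations: Valiant's hypothesis*, JSC 4 (1987), Prop. 4.8.
-/

noncomputable section

open MvPolynomial
open Literature.Computability.AlgebraicComplexity

namespace Summit.ValiantsHypothesis.ValiantsHypothesis.Theorems.DefinabilityGapK1wsNecessary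

open DefinabilityGapAffineRung DefinabilityGapWeakToK1ws DefinabilityGapK1Necessary

/-- A weakly-skew adversary of level `b` is a circuit adversary of level `b + 1`: `L_ws(D) ≤ q^b` gives `L(D) ≤ q^(b+1)` and
`deg D ≤ q^(b+1)` (`q = q(m) ≥ 2`). [cite: BurgisserEtAl2011, §9.1 (L_ws)] -/
theorem level_of_wsLevel {m b : ℕ} {D : MvPolynomial (Fin 3 → Fin (qOf m)) ℂ} (hws : wsComplexity D ≤ qOf m ^ b) :
    complexity D ≤ qOf m ^ (b + 1) ∧ D.totalDegree ≤ qOf m ^ (b + 1) := by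
  have hq : 2 ≤ qOf m := (qOf_spec m).2.two_le
  have hpow : 1 ≤ qOf m ^ b := Nat.one_le_pow _ _ (by omega)
  have hstep : qOf m ^ b + 1 ≤ qOf m ^ (b + 1) := by
    rw [pow_succ]
    nlinarith
  exact ⟨(complexity_le_wsComplexity D).trans (hws.trans (by omega)),
    (totalDegree_le_wsComplexity_succ D).trans (by omega)⟩

/-- **Pointwise hardness ⟹ weakly-skew hitting (unconditional).** For every `b` there is `c` such that at every `m` with
`L(per_m) > m^c + c` the planted map `G_m` hits every nonzero `D` with `L_ws(D) ≤ q(m)^b`.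
[cite: KabanetsImpagliazzo2003, Lemma 30; BurgisserEtAl2011, §9.1] -/
theorem kiPer_hitsWs_of_perm_hard (b : ℕ) : ∃ c : ℕ, ∀ m : ℕ, m ^ c + c < complexity (perPoly (Fin m) ℂ) →
    ∀ D : MvPolynomial (Fin 3 → Fin (qOf m)) ℂ, D ≠ 0 → wsComplexity D ≤ qOf m ^ b → bind₁ (kiPer m) D ≠ 0 := by
  obtain ⟨c, hc⟩ := kiPer_hits_of_perm_hard (b + 1)
  exact ⟨c, fun m hm D hD hws => hc m hm D hD (level_of_wsLevel hws).1 (level_of_wsLevel hws).2⟩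

/-- **Valiant's hypothesis ⟹ K1ws** — verbatim the split child `KIPlantedHittingWs` (in the `qOf`/`kiPer` spelling), with no
factor-closure hypothesis. [cite: KabanetsImpagliazzo2003, Thm. 7.7; Vonzurgathen1987Feasible, Prop. 4.8; BurgisserEtAl2011, §9.1] -/
theorem kiPlantedHittingWs_of_VP_ne_VNP (hV : VP ℂ ≠ VNP ℂ) :
    ∀ b m₀ : ℕ, ∃ m, m₀ ≤ m ∧ ∀ D : MvPolynomial (Fin 3 → Fin (qOf m)) ℂ, D ≠ 0 →
      wsComplexity D ≤ qOf m ^ b → bind₁ (kiPer m) D ≠ 0 := by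
  intro b m₀
  obtain ⟨m, hm, h⟩ := kiPlantedHitting_of_VP_ne_VNP hV (b + 1) m₀
  exact ⟨m, hm, fun D hD hws => h D hD (level_of_wsLevel hws).1 (level_of_wsLevel hws).2⟩

/-- **Dichotomy in `VBP` currency**: if K1ws fails then `VP_ℂ = VNP_ℂ`. [cite: KabanetsImpagliazzo2003, Thm. 7.7; Vonzurgathen1987Feasible, Prop. 4.8] -/
theorem VP_eq_VNP_of_not_kiPlantedHittingWs
    (hK : ¬ ∀ b m₀ : ℕ, ∃ m, m₀ ≤ m ∧ ∀ D : MvPolynomial (Fin 3 → Fin (qOf m)) ℂ, D ≠ 0 →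
      wsComplexity D ≤ qOf m ^ b → bind₁ (kiPer m) D ≠ 0) :
    VP ℂ = VNP ℂ := by
  by_contra hV
  exact hK (kiPlantedHittingWs_of_VP_ne_VNP hV)

end Summit.ValiantsHypothesis.ValiantsHypothesis.Theorems.DefinabilityGapK1wsNecessary

end
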